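import Summits.HodgeConjecture.HodgeConjecture.Theorems.K2E3BranchBSkewLineIntegrals               -- ★ (K2E3-p03) `valued_invOf_two_apply`; brings ★ `K2E3BranchBSkewUnitSign.forall_placesOver_of_apply`, `HeisRing.map_invOf_two`
import HarnessLib

/-!
# R90 · S1 ∕ U4Keys leaf (U4f-χ₁-ram-one-d0B) — THE SIGN LETTER OF THE RAMIFIED SHELL ZERO: `c₀ = χ₁(−½)` has `c₀² = 1` and `χ₁(−½) = χ₁(−2)` (Branch B on the fixed unit `−½`, `|2|_w = 1`)
# [Keys1984 §7 Thm (2) (d); Rogawski1990 §12.2 (2); PAPER-Z3-DepthZeroRamified §1 (R90-C10-p05 (g0), r01-screened)]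

Cell `hodgecm-mathlib`, SLAB R90-TF, section S1 «Ch. 12 local», crux H413 = `stmt-HodgeConjecture-24833` (lane `--supports … --as helper`), route HCCMUnconditional; prover seat
`hodgecm-mathlib-R90-C10-p05` (g0).  THEOREMS ONLY (no definition ∕ instance ∕ notation ∕ named fact ∕ `sorry`); ★-only imports.  FRAME (v1 spellings): `R := LocalRing L v`,
`σ := conjLocal L c v`, `v` non-split (`hw`), `|2|_w = 1` (`h2w`, `[Invertible (2 : R)]`); the :155 letter `hB` (Branch B).  Any non-split place (inert or ramified).
THE POINT.  The ramified shell-zero fibre (★ `R90S1RamifiedShellZeroFibre.heisZFibre_eq_of_valued_eq_one_ram`) carries the constant `c₀ = χ₁(u)`, `u = −(unitOfInvertible 2)⁻¹ = −½ ∈ Rˣ`;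
the wrapper ★ `R90S1KeysThmTwoDepthZeroBranchBRamified.exists_eta_of_reducible_of_shellIdentities_ram` wants the letter `c₀² = 1`, and PAPER-Z3-DepthZeroRamified §1 writes the constant as
`χ₁(−2)`.  Both follow from Branch B: `u` is `σ`-fixed with `|u_{w′}| = 1`, so `hB u : χ₁(u·σu) = χ₁(u)² = 1`, and then `χ₁(u) = χ₁(u)⁻¹ = χ₁(u⁻¹) = χ₁(−2)`.
* **`chi_neg_inv_two_sq_eq_one`**, **`chi_neg_inv_two_eq_chi_neg_two`**.
HONEST LABEL.  HC_CM is proved only modulo the 7 printed citations (2 remaining named inputs: hLiu418 = `stmt-HodgeConjecture-24832`, h413 = `stmt-HodgeConjecture-24833`) until rung 0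
closes; count-neutral — this file does NOT pay the leaf; no printed citation is discharged.

## References
* [Keys1984] D. Keys, *Principal series representations of special unitary groups over local fields*, Compositio Math. 51 (1984), §7 Theorem (2) (d) p. 126.
* [Rogawski1990] J. D. Rogawski, *Automorphic Representations of Unitary Groups in Three Variables*, Ann. of Math. Stud. 123 (1990), §12.2 (2) p. 173.
-/

set_option autoImplicit false
-- the mandated namespace has the single-problem summit's repeated segment (`HodgeConjecture.HodgeConjecture`)
set_option linter.dupNamespace false

noncomputable section

open NumberField IsDedekindDomain
open Literature.NumberTheory Literature.NumberTheory.Automorphic Literature.NumberTheory.Automorphic.UnitaryGroup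

namespace Summit.HodgeConjecture.HodgeConjecture.R90.S1

open Summit.HodgeConjecture.HodgeConjecture.Cruxes.H413
open Summit.HodgeConjecture.HodgeConjecture.Cruxes.H413.K2E3BranchBSkewUnitSign
open Summit.HodgeConjecture.HodgeConjecture.Cruxes.H413.K2E3BranchBSkewLineIntegrals

variable (L : Type) [Field L] [NumberField L] [IsCMField L] (v : HeightOneSpectrum (𝓞 ↥(maximalRealSubfield L)))
  (w : PlacesOver L v) (hw : IsCMField.complexConj L • w.1 = w.1)

include hw in
/-- **`χ₁(−½)·χ₁(−½) = 1` in Branch B** (`v` non-split, `|2|_w = 1`): the unit `u = −(unitOfInvertible 2)⁻¹` is `σ`-fixed (★ `HeisRing.map_invOf_two`) with `|u_{w′}|_{w′} = 1` (★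
`valued_invOf_two_apply`), so `hB u` reads `χ₁(u·u) = 1`. [cite: Keys1984, §7 Theorem (2) (d) p. 126] [cite: Rogawski1990, §12.2 (2) p. 173] -/
theorem chi_neg_inv_two_mul_self_eq_one [Invertible (2 : LocalRing L v)] (h2w : Valued.v (2 : w.1.adicCompletion L) = 1) (χ₁ : (LocalRing L v)ˣ →* ℂˣ)
    (hB : ∀ u : (LocalRing L v)ˣ, (∀ w' : PlacesOver L v, Valued.v ((u : LocalRing L v) w') = 1) →
      χ₁ (u * Units.map (conjLocal L (IsCMField.complexConj L) v : LocalRing L v →* LocalRing L v) u) = 1) :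
    χ₁ (-(unitOfInvertible (2 : LocalRing L v))⁻¹) * χ₁ (-(unitOfInvertible (2 : LocalRing L v))⁻¹) = 1 := by
  have hval : ((-(unitOfInvertible (2 : LocalRing L v))⁻¹ : (LocalRing L v)ˣ) : LocalRing L v) = -(⅟ (2 : LocalRing L v)) := by
    rw [Units.val_neg, val_inv_unitOfInvertible]
  have hfix : Units.map (conjLocal L (IsCMField.complexConj L) v : LocalRing L v →* LocalRing L v) (-(unitOfInvertible (2 : LocalRing L v))⁻¹) =
      -(unitOfInvertible (2 : LocalRing L v))⁻¹ := by
    ext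
    rw [Units.coe_map, MonoidHom.coe_coe, hval, map_neg, HeisRing.map_invOf_two (conjLocal L (IsCMField.complexConj L) v)]
  have h1 : ∀ w' : PlacesOver L v, Valued.v (((-(unitOfInvertible (2 : LocalRing L v))⁻¹ : (LocalRing L v)ˣ) : LocalRing L v) w') = 1 := by
    refine forall_placesOver_of_apply L v w hw (P := fun w' => Valued.v (((-(unitOfInvertible (2 : LocalRing L v))⁻¹ : (LocalRing L v)ˣ) : LocalRing L v) w') = 1) ?_
    show Valued.v (((-(unitOfInvertible (2 : LocalRing L v))⁻¹ : (LocalRing L v)ˣ) : LocalRing L v) w) = 1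
    rw [hval, Pi.neg_apply, Valuation.map_neg, valued_invOf_two_apply L v w h2w]
  have h := hB _ h1
  rwa [hfix, map_mul] at h

include hw in
/-- **`c₀² = 1` for `c₀ = χ₁(−½)`** (as a complex number) — the sign letter `hc` of ★ `exists_eta_of_reducible_of_shellIdentities_ram` for the ramified shell-zero constant.
[cite: Keys1984, §7 Theorem (2) (d) p. 126] -/
theorem chi_neg_inv_two_sq_eq_one [Invertible (2 : LocalRing L v)] (h2w : Valued.v (2 : w.1.adicCompletion L) = 1) (χ₁ : (LocalRing L v)ˣ →* ℂˣ)
    (hB : ∀ u : (LocalRing L v)ˣ, (∀ w' : PlacesOver L v, Valued.v ((u : LocalRing L v) w') = 1) →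
      χ₁ (u * Units.map (conjLocal L (IsCMField.complexConj L) v : LocalRing L v →* LocalRing L v) u) = 1) :
    ((χ₁ (-(unitOfInvertible (2 : LocalRing L v))⁻¹) : ℂˣ) : ℂ) ^ 2 = 1 := by
  rw [sq, ← Units.val_mul, chi_neg_inv_two_mul_self_eq_one L v w hw h2w χ₁ hB, Units.val_one]

include hw in
/-- **`χ₁(−½) = χ₁(−2)`** in Branch B: `χ₁(u)² = 1` gives `χ₁(u) = χ₁(u)⁻¹ = χ₁(u⁻¹)` and `u⁻¹ = −(unitOfInvertible 2) = −2` — the constant of PAPER-Z3-DepthZeroRamified §1 and of the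
docstring of ★ `R90S1BranchBClosedFormsRamified` (`c₀ = χ₁(−2)`). [cite: Keys1984, §7 Theorem (2) (d) p. 126] -/
theorem chi_neg_inv_two_eq_chi_neg_two [Invertible (2 : LocalRing L v)] (h2w : Valued.v (2 : w.1.adicCompletion L) = 1) (χ₁ : (LocalRing L v)ˣ →* ℂˣ)
    (hB : ∀ u : (LocalRing L v)ˣ, (∀ w' : PlacesOver L v, Valued.v ((u : LocalRing L v) w') = 1) →
      χ₁ (u * Units.map (conjLocal L (IsCMField.complexConj L) v : LocalRing L v →* LocalRing L v) u) = 1) :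
    χ₁ (-(unitOfInvertible (2 : LocalRing L v))⁻¹) = χ₁ (-(unitOfInvertible (2 : LocalRing L v))) := by
  have h := chi_neg_inv_two_mul_self_eq_one L v w hw h2w χ₁ hB
  rw [eq_inv_of_mul_eq_one_left h, ← map_inv, neg_inv, inv_inv]

end Summit.HodgeConjecture.HodgeConjecture.R90.S1

end
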